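import Literature.Geometry.Lorentzian.CoordAdjointCutoff
import Literature.Geometry.Lorentzian.CoordDivergenceIntegral
import HarnessLib

/-!
# The integrated Green identity for the linearised momentum constraint against a cut-off field:
# `∫ √g ψ DM(γ,κ)(X) = ∫ √g (⟨γ, DM*ˢ_γ(ψX)⟩ + ⟨κ, DM*ˢ_κ(ψX)⟩)`

Everything here is PROVED; no definition and no statement of `Prop` type is introduced.

For metric components `G` Riemannian on an open set `V` (coordinate tensor calculus
`MetricCoord.IsMetricOn`), smooth symmetric `K, γ, κ` and a smooth vector field `X` on `V`, and a
smooth cut-off `ψ` with compact support inside `V`, the pointwise Green identity of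
`CoordConstraintAdjoint.lean` (`IsMetricOn.linConstraint_pairing_eq_sym` with `N = 0`,
`X ↦ ψX`) integrates, by the coordinate divergence theorem of `CoordDivergenceIntegral.lean`
(`IsMetricOn.integral_sqrtDetGram_mul_divAt_eq_zero`: the boundary field `momGreenVec` of the
identity is pointwise linear in `ψX`, hence compactly supported in `V`), to

* **`IsMetricOn.integral_sqrtDetGram_mul_linMomFn_smul_eq`** —
  `∫ √det g · ψ · DM_{(G,K)}(γ,κ)(X) dμ = ∫ √det g · (⟨γ, DM*ˢ_γ(ψX)⟩_G + ⟨κ, DM*ˢ_κ(ψX)⟩_G) dμ`.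

This is the integration by parts behind the cokernel projections `𝓘_α` of Li–Mei 2020, Prop. 4.1
(arXiv:2005.01249, p. 23, `(I_α)`: "`∫_H ⟨DΦ(h,ω), (0,Ω_α)⟩ = …` by the divergence theorem"),
here with a compactly supported cut-off instead of boundary terms; for a tangential KID `X`
(`SchwarzschildCylinderKIDs.lean`) the right-hand side only involves the commutator
`[DM*ˢ, ψ](X)` of `CoordAdjointCutoff.lean`, supported on `supp dψ`.

Also proved (the regularity bookkeeping): `IsMetricOn.contDiffOn_covDAt`, `contDiffOn_divAt`,
`contDiffOn_symAt`, `IsMetricOn.contDiffOn_pairAt`, `contDiffOn_adjMomKS`, `contDiffOn_adjMomGS`,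
`contDiffOn_momGreenVec`; `linMomFn_smul` (linearity in the vector), `greenVec_zero`
(the `DS`-boundary field vanishes for `N = 0`), `adjMomKS_eq_zero_of_eventuallyEq`,
`adjMomGS_eq_zero_of_eventuallyEq` (the adjoint rows of a field vanishing near the point vanish).

## References

* J. Li, H. Mei, Comm. Math. Phys. 378 (2020), arXiv:2005.01249, §4, p. 23. [LiMei2020]
* P. T. Chruściel, E. Delay, Mém. SMF 94 (2003), §2–§3. [ChruscielDelay2003]
* B. O'Neill, *Semi-Riemannian geometry*, 1983, Ch. 7, Lemma 7.21. [ONeill1983]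
-/

noncomputable section

set_option maxSynthPendingDepth 3

open Set Filter ContinuousLinearMap Module MeasureTheory Function
open scoped Topology ContDiff

namespace Literature.Geometry.Lorentzian

namespace MetricCoord

variable {E : Type*} [NormedAddCommGroup E] [NormedSpace ℝ E] [FiniteDimensional ℝ E]
  [CompleteSpace E] {G : E → E →L[ℝ] E →L[ℝ] ℝ} {V : Set E} {x : E}

/-! ### Regularity of the adjoint rows and of the boundary field -/

section Regularity

omit [FiniteDimensional ℝ E] in
/-- The covariant differential of a smooth vector field is smooth on `V`. [folklore] -/
theorem IsMetricOn.contDiffOn_covDAt (hG : IsMetricOn G V) {Z : E → E} (hZ : ContDiffOn ℝ ∞ Z V) :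
    ContDiffOn ℝ ∞ (covDAt G Z) V := by
  have h : covDAt G Z = fun y ↦ fderiv ℝ Z y + chrAt G y (Z y) := rfl
  rw [h]
  exact (hZ.fderiv_of_isOpen hG.isOpen (by simp)).add (hG.contDiffOn_chrAt.clm_apply hZ)

/-- The divergence of a smooth vector field is smooth on `V`. [folklore] -/
theorem IsMetricOn.contDiffOn_divAt (hG : IsMetricOn G V) {Z : E → E} (hZ : ContDiffOn ℝ ∞ Z V) :
    ContDiffOn ℝ ∞ (divAt G Z) V := by
  have h : divAt G Z = fun y ↦ traceCLM E (covDAt G Z y) := rfl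
  rw [h]
  exact (traceCLM E).contDiff.comp_contDiffOn (hG.contDiffOn_covDAt hZ)

omit [FiniteDimensional ℝ E] [CompleteSpace E] in
/-- Symmetrisation preserves smoothness. [folklore] -/
theorem contDiffOn_symAt {T : E → E →L[ℝ] E →L[ℝ] ℝ} (hT : ContDiffOn ℝ ∞ T V) :
    ContDiffOn ℝ ∞ (fun y ↦ symAt (T y)) V := by
  have h : (fun y ↦ symAt (T y)) = fun y ↦ (2⁻¹ : ℝ) • (T y + flipCLM (T y)) := by
    funext y; rw [symAt, flipCLM_apply]
  rw [h]
  exact (contDiffOn_const (c := (2⁻¹ : ℝ))).smul (hT.add (flipCLM.contDiff.comp_contDiffOn hT))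

/-- The metric pairing of smooth fields of forms is smooth on `V`. [folklore] -/
theorem IsMetricOn.contDiffOn_pairAt (hG : IsMetricOn G V) {α β : E → E →L[ℝ] E →L[ℝ] ℝ}
    (hα : ContDiffOn ℝ ∞ α V) (hβ : ContDiffOn ℝ ∞ β V) :
    ContDiffOn ℝ ∞ (fun y ↦ pairAt G y (α y) (β y)) V := by
  have h : (fun y ↦ pairAt G y (α y) (β y)) =
      fun y ↦ traceCLM E (((sharpAt G y).comp (α y)).comp ((sharpAt G y).comp (β y))) := rfl
  rw [h]
  have hS := hG.contDiffOn_sharpAt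
  exact (traceCLM E).contDiff.comp_contDiffOn ((hS.clm_comp hα).clm_comp (hS.clm_comp hβ))

/-- **The `κ`-row `DM*ˢ_κ(X)` of a smooth field is smooth on `V`.** [folklore] -/
theorem IsMetricOn.contDiffOn_adjMomKS (hG : IsMetricOn G V) {X : E → E}
    (hX : ContDiffOn ℝ ∞ X V) : ContDiffOn ℝ ∞ (adjMomKS G X) V := by
  have h : adjMomKS G X = fun y ↦ -symAt ((G y).comp (covDAt G X y)) + (divAt G X y) • G y := rfl
  rw [h]
  have h1 : ContDiffOn ℝ ∞ (fun y ↦ symAt ((G y).comp (covDAt G X y))) V :=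
    contDiffOn_symAt (hG.contDiffOn.clm_comp (hG.contDiffOn_covDAt hX))
  have h2 : ContDiffOn ℝ ∞ (fun y ↦ (divAt G X y) • G y) V := (hG.contDiffOn_divAt hX).smul hG.contDiffOn
  exact h1.neg.add h2

/-- **The `γ`-row `DM*ˢ_γ(X)` of smooth fields is smooth on `V`.** [folklore] -/
theorem IsMetricOn.contDiffOn_adjMomGS (hG : IsMetricOn G V) {K : E → E →L[ℝ] E →L[ℝ] ℝ}
    (hK : ContDiffOn ℝ ∞ K V) {X : E → E} (hX : ContDiffOn ℝ ∞ X V) :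
    ContDiffOn ℝ ∞ (adjMomGS G K X) V := by
  have h : adjMomGS G K X = fun y ↦ symAt ((K y).comp (covDAt G X y))
      + (2⁻¹ : ℝ) • cov₂At G K y (X y)
      - (2⁻¹ * divAt G (fun z ↦ sharpAt G z (K z (X z))) y) • G y
      - (2⁻¹ * divAt G X y) • K y := rfl
  rw [h]
  have hY : ContDiffOn ℝ ∞ (fun z ↦ sharpAt G z (K z (X z))) V :=
    hG.contDiffOn_sharpAt.clm_apply (hK.clm_apply hX)
  have h1 : ContDiffOn ℝ ∞ (fun y ↦ symAt ((K y).comp (covDAt G X y))) V :=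
    contDiffOn_symAt (hK.clm_comp (hG.contDiffOn_covDAt hX))
  have h2 : ContDiffOn ℝ ∞ (fun y ↦ (2⁻¹ : ℝ) • cov₂At G K y (X y)) V :=
    (contDiffOn_const (c := (2⁻¹ : ℝ))).smul ((hG.contDiffOn_cov₂At hK).clm_apply hX)
  have h3 : ContDiffOn ℝ ∞ (fun y ↦ (2⁻¹ * divAt G (fun z ↦ sharpAt G z (K z (X z))) y) • G y) V :=
    ((contDiffOn_const (c := (2⁻¹ : ℝ))).mul (hG.contDiffOn_divAt hY)).smul hG.contDiffOn
  have h4 : ContDiffOn ℝ ∞ (fun y ↦ (2⁻¹ * divAt G X y) • K y) V :=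
    ((contDiffOn_const (c := (2⁻¹ : ℝ))).mul (hG.contDiffOn_divAt hX)).smul hK
  exact ((h1.add h2).sub h3).sub h4

/-- **The boundary field `momGreenVec` of the `DM`-Green identity is smooth on `V`.** [folklore] -/
theorem IsMetricOn.contDiffOn_momGreenVec (hG : IsMetricOn G V) {K γ κ : E → E →L[ℝ] E →L[ℝ] ℝ}
    (hK : ContDiffOn ℝ ∞ K V) (hγ : ContDiffOn ℝ ∞ γ V) (hκ : ContDiffOn ℝ ∞ κ V) {X : E → E}
    (hX : ContDiffOn ℝ ∞ X V) : ContDiffOn ℝ ∞ (momGreenVec G K γ κ X) V := by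
  have h : momGreenVec G K γ κ X = fun y ↦ sharpAt G y (κ y (X y)) - mtrAt G y (κ y) • X y
      - sharpAt G y (γ y (sharpAt G y (K y (X y))))
      + (2⁻¹ * mtrAt G y (γ y)) • sharpAt G y (K y (X y))
      + (2⁻¹ * pairAt G y (γ y) (K y)) • X y := rfl
  rw [h]
  have hS := hG.contDiffOn_sharpAt
  have hY : ContDiffOn ℝ ∞ (fun z ↦ sharpAt G z (K z (X z))) V := hS.clm_apply (hK.clm_apply hX)
  have h1 : ContDiffOn ℝ ∞ (fun y ↦ sharpAt G y (κ y (X y))) V := hS.clm_apply (hκ.clm_apply hX)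
  have h2 : ContDiffOn ℝ ∞ (fun y ↦ mtrAt G y (κ y) • X y) V := (hG.contDiffOn_mtrAt hκ).smul hX
  have h3 : ContDiffOn ℝ ∞ (fun y ↦ sharpAt G y (γ y (sharpAt G y (K y (X y))))) V :=
    hS.clm_apply (hγ.clm_apply hY)
  have h4 : ContDiffOn ℝ ∞ (fun y ↦ (2⁻¹ * mtrAt G y (γ y)) • sharpAt G y (K y (X y))) V :=
    ((contDiffOn_const (c := (2⁻¹ : ℝ))).mul (hG.contDiffOn_mtrAt hγ)).smul hY
  have h5 : ContDiffOn ℝ ∞ (fun y ↦ (2⁻¹ * pairAt G y (γ y) (K y)) • X y) V :=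
    ((contDiffOn_const (c := (2⁻¹ : ℝ))).mul (hG.contDiffOn_pairAt hγ hK)).smul hX
  exact (((h1.sub h2).sub h3).add h4).add h5

end Regularity

/-! ### Algebra: linearity in the vector, vanishing for `N = 0` and off the support -/

section Algebra

variable {ι : Type*} [Fintype ι] (b : Basis ι ℝ E)

omit [CompleteSpace E] in
/-- `DM(γ,κ)` is linear in the vector: `DM(γ,κ)(c Z) = c DM(γ,κ)(Z)`. [cite: ChruscielDelay2003, §2] -/
theorem linMomFn_smul (K γ κ : E → E →L[ℝ] E →L[ℝ] ℝ) (x : E) (c : ℝ) (Z : E) :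
    linMomFn b G K γ κ x (c • Z) = c * linMomFn b G K γ κ x Z := by
  rw [linMomFn_eq, linMomFn_eq]
  simp only [map_smul, smul_eq_mul]
  rw [mul_sub, Finset.mul_sum]
  congr 1
  refine Finset.sum_congr rfl fun k _ ↦ ?_
  rw [Finset.mul_sum]
  refine Finset.sum_congr rfl fun l _ ↦ ?_
  ring

omit [CompleteSpace E] in
/-- **The `DS`-boundary field vanishes for `N = 0`**: `greenVec b G 0 γ = 0`. [folklore] -/
theorem greenVec_zero (γ : E → E →L[ℝ] E →L[ℝ] ℝ) (x : E) :
    greenVec b G (fun _ ↦ (0 : ℝ)) γ x = 0 := by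
  rw [greenVec]
  simp [fderiv_fun_const]

omit [Fintype ι] [FiniteDimensional ℝ E] [CompleteSpace E] in
/-- The covariant differential of a field vanishing near `x` vanishes at `x`. [folklore] -/
theorem covDAt_eq_zero_of_eventuallyEq {Z : E → E} (hZ : Z =ᶠ[𝓝 x] fun _ ↦ 0) :
    covDAt G Z x = 0 := by
  rw [covDAt, hZ.fderiv_eq, fderiv_fun_const, hZ.self_of_nhds, map_zero]
  simp

omit [Fintype ι] [CompleteSpace E] in
/-- **`DM*ˢ_κ(X) = 0` at `x` if `X` vanishes near `x`.** [folklore] -/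
theorem adjMomKS_eq_zero_of_eventuallyEq {X : E → E} (hX : X =ᶠ[𝓝 x] fun _ ↦ 0) :
    adjMomKS G X x = 0 := by
  rw [adjMomKS, covDAt_eq_zero_of_eventuallyEq hX, divAt_eq_zero_of_eventuallyEq_zero hX,
    ContinuousLinearMap.comp_zero, zero_smul, add_zero, neg_eq_zero]
  ext v w
  simp [symAt_apply]

omit [Fintype ι] [CompleteSpace E] in
/-- **`DM*ˢ_γ(X) = 0` at `x` if `X` vanishes near `x`.** [folklore] -/
theorem adjMomGS_eq_zero_of_eventuallyEq {K : E → E →L[ℝ] E →L[ℝ] ℝ} {X : E → E}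
    (hX : X =ᶠ[𝓝 x] fun _ ↦ 0) : adjMomGS G K X x = 0 := by
  have hY : (fun y ↦ sharpAt G y (K y (X y))) =ᶠ[𝓝 x] fun _ ↦ 0 :=
    hX.mono fun y hy ↦ by simp [hy]
  rw [adjMomGS, covDAt_eq_zero_of_eventuallyEq hX, divAt_eq_zero_of_eventuallyEq_zero hX,
    divAt_eq_zero_of_eventuallyEq_zero hY, hX.self_of_nhds, map_zero, ContinuousLinearMap.comp_zero,
    mul_zero, zero_smul, zero_smul, smul_zero, sub_zero, sub_zero, add_zero]
  ext v w
  simp [symAt_apply]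

end Algebra

/-! ### The integrated identity -/

section Integral

variable {ι : Type*} [Fintype ι] [DecidableEq ι] (b : Basis ι ℝ E) [MeasurableSpace E]
  [BorelSpace E] (μ : Measure E) [μ.IsAddHaarMeasure]

/-- **The integrated Green identity for `DM` against a cut-off field.** For `G` Riemannian on
`V`, smooth symmetric `K, γ, κ` and a smooth vector field `X` on `V`, and a smooth cut-off `ψ`
whose support is a compact subset of `V`:
`∫ √det g · ψ DM_{(G,K)}(γ,κ)(X) dμ = ∫ √det g · (⟨γ, DM*ˢ_γ(ψX)⟩_G + ⟨κ, DM*ˢ_κ(ψX)⟩_G) dμ`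
(both integrands vanish off `supp ψ`). Li–Mei 2020, proof of Prop. 4.1, p. 23 (the integration
by parts producing `(I_α)`), with the boundary terms replaced by the cut-off.
[cite: LiMei2020, proof of Prop. 4.1, p. 23] -/
theorem IsMetricOn.integral_sqrtDetGram_mul_linMomFn_smul_eq (hG : IsMetricOn G V)
    (hpos : ∀ y ∈ V, ∀ v : E, v ≠ 0 → 0 < G y v v)
    {K γ κ : E → E →L[ℝ] E →L[ℝ] ℝ} (hK : ContDiffOn ℝ ∞ K V) (hKs : ∀ y ∈ V, ∀ v w, K y v w = K y w v)
    (hγ : ContDiffOn ℝ ∞ γ V) (hγs : ∀ y ∈ V, ∀ v w, γ y v w = γ y w v)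
    (hκ : ContDiffOn ℝ ∞ κ V) (hκs : ∀ y ∈ V, ∀ v w, κ y v w = κ y w v)
    {X : E → E} (hX : ContDiffOn ℝ ∞ X V) {ψ : E → ℝ} (hψ : ContDiff ℝ ∞ ψ)
    (hψc : HasCompactSupport ψ) (hψV : tsupport ψ ⊆ V) :
    ∫ x, sqrtDetGram G b x * (ψ x * linMomFn b G K γ κ x (X x)) ∂μ =
      ∫ x, sqrtDetGram G b x *
        (pairAt G x (γ x) (adjMomGS G K (fun y ↦ ψ y • X y) x)
          + pairAt G x (κ x) (adjMomKS G (fun y ↦ ψ y • X y) x)) ∂μ := by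
  set X' : E → E := fun y ↦ ψ y • X y with hX'
  have hX's : ContDiffOn ℝ ∞ X' V := hψ.contDiffOn.smul hX
  -- `X'` and everything built pointwise-linearly from it vanish near points off `tsupport ψ`
  have hX'zero : ∀ x ∉ tsupport ψ, X' =ᶠ[𝓝 x] fun _ ↦ 0 := fun x hx ↦
    (notMem_tsupport_iff_eventuallyEq.mp hx).mono fun y hy ↦ by
      simp [hX', show ψ y = 0 from hy]
  -- the boundary field
  set B : E → E := momGreenVec G K γ κ X' with hB
  have hBs : ContDiffOn ℝ ∞ B V := hG.contDiffOn_momGreenVec hK hγ hκ hX's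
  have hBzero : ∀ x ∉ tsupport ψ, B =ᶠ[𝓝 x] fun _ ↦ 0 := fun x hx ↦
    (hX'zero x hx).mono fun y hy ↦ by
      simp only [hB, momGreenVec, hy, map_zero, smul_zero, add_zero, sub_self]
  have hBsupp : tsupport B ⊆ tsupport ψ := by
    intro x hx
    by_contra hxψ
    exact (notMem_tsupport_iff_eventuallyEq.mpr (hBzero x hxψ)) hx
  have hBc : HasCompactSupport B := hψc.mono' (by
    intro x hx
    by_contra hxψ
    have h0 := (hBzero x hxψ).self_of_nhds
    exact hx h0)
  have hBV : tsupport B ⊆ V := hBsupp.trans hψV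
  -- pointwise identity on `V`
  have hfh : ∀ x ∈ V, ψ x * linMomFn b G K γ κ x (X x) =
      (pairAt G x (γ x) (adjMomGS G K X' x) + pairAt G x (κ x) (adjMomKS G X' x))
        + divAt G B x := by
    intro x hx
    have h := hG.linConstraint_pairing_eq_sym b hx hK hKs hγ hγs hκ hκs (N := fun _ ↦ (0 : ℝ))
      contDiffOn_const hX's
    rw [zero_mul, zero_add, adjHamG_zero, adjHamK_zero, zero_add, zero_add,
      show greenVec b G (fun _ ↦ (0 : ℝ)) γ = fun _ ↦ 0 from funext fun y ↦ greenVec_zero b γ y,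
      divAt_eq_zero_of_eventuallyEq_zero (Filter.Eventually.of_forall fun _ ↦ rfl), zero_add] at h
    rw [← h, hX', linMomFn_smul]
  -- vanishing off `V`
  have hf : ∀ x ∉ V, ψ x * linMomFn b G K γ κ x (X x) = 0 := fun x hx ↦ by
    have hxψ : x ∉ tsupport ψ := fun h ↦ hx (hψV h)
    rw [image_eq_zero_of_notMem_tsupport hxψ, zero_mul]
  have hh : ∀ x ∉ V, pairAt G x (γ x) (adjMomGS G K X' x) + pairAt G x (κ x) (adjMomKS G X' x) = 0 :=
    fun x hx ↦ by
      have hxψ : x ∉ tsupport ψ := fun h ↦ hx (hψV h)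
      rw [adjMomGS_eq_zero_of_eventuallyEq (hX'zero x hxψ),
        adjMomKS_eq_zero_of_eventuallyEq (hX'zero x hxψ)]
      simp [pairAt_apply]
  -- integrability of `√g h`: continuous with compact support
  have hhc : Continuous fun x ↦ sqrtDetGram G b x *
      (pairAt G x (γ x) (adjMomGS G K X' x) + pairAt G x (κ x) (adjMomKS G X' x)) := by
    rw [continuous_iff_continuousAt]
    intro x
    by_cases hx : x ∈ tsupport ψ
    · have hxV := hψV hx
      have hsm : ContDiffOn ℝ ∞ (fun x ↦ sqrtDetGram G b x *
          (pairAt G x (γ x) (adjMomGS G K X' x) + pairAt G x (κ x) (adjMomKS G X' x))) V :=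
        (hG.contDiffOn_sqrtDetGram b hpos).mul
          ((hG.contDiffOn_pairAt hγ (hG.contDiffOn_adjMomGS hK hX's)).add
            (hG.contDiffOn_pairAt hκ (hG.contDiffOn_adjMomKS hX's)))
      exact (hsm.continuousOn.continuousWithinAt hxV).continuousAt (hG.mem_nhds hxV)
    · -- near `x`, `X'` vanishes on an open neighbourhood, hence so do the adjoint rows
      obtain ⟨U, hU, hUo, hxU⟩ := mem_nhds_iff.1 (hX'zero x hx)
      have h0 : (fun x ↦ sqrtDetGram G b x *
          (pairAt G x (γ x) (adjMomGS G K X' x) + pairAt G x (κ x) (adjMomKS G X' x))) =ᶠ[𝓝 x]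
          fun _ ↦ 0 := by
        filter_upwards [hUo.mem_nhds hxU] with y hy
        have hyX : X' =ᶠ[𝓝 y] fun _ ↦ 0 :=
          Filter.eventually_of_mem (hUo.mem_nhds hy) fun z hz ↦ hU hz
        rw [adjMomGS_eq_zero_of_eventuallyEq hyX, adjMomKS_eq_zero_of_eventuallyEq hyX]
        simp [pairAt_apply]
      exact continuousAt_const.congr_of_eventuallyEq h0
  have hhsupp : HasCompactSupport fun x ↦ sqrtDetGram G b x *
      (pairAt G x (γ x) (adjMomGS G K X' x) + pairAt G x (κ x) (adjMomKS G X' x)) := by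
    refine hψc.mono' fun x hx ↦ ?_
    by_contra hxψ
    apply hx
    show sqrtDetGram G b x *
      (pairAt G x (γ x) (adjMomGS G K X' x) + pairAt G x (κ x) (adjMomKS G X' x)) = 0
    rw [adjMomGS_eq_zero_of_eventuallyEq (hX'zero x hxψ),
      adjMomKS_eq_zero_of_eventuallyEq (hX'zero x hxψ)]
    simp [pairAt_apply]
  have hhi : Integrable (fun x ↦ sqrtDetGram G b x *
      (pairAt G x (γ x) (adjMomGS G K X' x) + pairAt G x (κ x) (adjMomKS G X' x))) μ :=
    hhc.integrable_of_hasCompactSupport hhsupp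
  exact hG.integral_sqrtDetGram_mul_eq_of_eq_add_divAt b μ hpos hBs hBc hBV hfh hf hh hhi

end Integral

end MetricCoord

end Literature.Geometry.Lorentzian

end
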